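import Summits.ABC.ABC.Theses.IsogenyGlueCongruence
import Literature.NumberTheory.EllipticCurves.AbelianVarietyBridgeProofs
import Literature.NumberTheory.EllipticCurves.ModularParametrizationProofs
import Literature.NumberTheory.EllipticCurves.ModularParametrizationHoldsProofs
import Literature.NumberTheory.EllipticCurves.GaloisActionProofs
import Literature.NumberTheory.EllipticCurves.IsogenyHomProofs
import Literature.NumberTheory.EllipticCurves.RankinSymmSquareGL2Bound
import HarnessLib

/-!
# Route IsogenyGlueCongruence, item `ModularJacobianMultipliers` (stmt-ABC-13920): the glue
around the modular Jacobian, and the exact dependency on modularity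

`ModularJacobianMultipliers` (the modular instance of the route's lever U) asks, for every semistable
elliptic `W/ℚ` given by a globally minimal model of conductor `N`, for a modular parametrisation datum
`D : ModularParametrizationData W N`, abelian varieties `E, J` over `ℚ` with `E(ℚ̄) ≃ W(ℚ̄)`
`Γ_ℚ`-equivariantly, `dim J ≤ N²`, a non-zero `E`-multiplier of `J` (`α ≫ β = n • 𝟙 E`), and
`D.modularDegree ∣ n` for every `E`-multiplier `n` of `J`. Mathematically `J = J₀(N)` (Shimura), `E`
the plane cubic of `W`, `D` the minimal parametrisation, and the divisibility is multiplicity one for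
the optimal quotient (Agashe–Ribet–Stein 2012, §2.1; Zagier 1985, Thm. 3).

This file proves, unconditionally, everything in that statement that does not live on `J₀(N)`:

* `genusX0_le_sq`: `g(X₀(N)) ≤ N²` for `N ≥ 1` (the dimension bound `dim J₀(N) = g(X₀(N)) ≤ N²`
  of the item, from the genus formula `12 g = 12 + μ − 3ν₂ − 4ν₃ − 6ν_∞`, Shimura Prop. 1.40/1.43,
  and the tree's `[SL₂(ℤ) : Γ₀(N)] ≤ N²`, `gamma0Index_le_sq`);
* `exists_forall_modularDegree_le`: a non-empty type of parametrisation data has a datum of minimal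
  degree; `exists_minimal_modularParametrizationData_of_modularity`: under the named fact
  `exists_isNewformOf` (modularity, BCDT 2001 Thm. A) every globally minimal elliptic `W/ℚ` has a
  minimal-degree datum at level `N_W` (the tree's `nonempty_modularParametrizationData_of_modularity`
  with the discharged `IsNewformOf.exists_maninConstant_modularDegree_holds`);
* `exists_abelianVariety_geomPoints_equiv`: the `E`-part — an abelian variety `E/ℚ` with a
  `Γ_ℚ`-equivariant `E(ℚ̄) ≃+ W(ℚ̄)` — is a THEOREM of the tree
  (`WeierstrassCurve.nonempty_abelianVarietyBridge_holds`: the smooth plane cubic with the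
  chord–tangent law, Silverman AEC III.3.6);
* `zsmul_id_ne_zero_of_geomPoints_equiv`: `m • 𝟙 E ≠ 0` for `m ≠ 0` on such an `E` (torsion of
  `W(ℚ̄)` is finite, `W(ℚ̄)` is infinite); `dvd_of_comp_eq_zsmul_id_of_generators`,
  `multipliers_of_generators`: if `Hom(E, J) = ℤι`, `Hom(J, E) = ℤπ`, `ι ≫ π = d • 𝟙 E`, `d ≠ 0`,
  then `d` is a non-zero `E`-multiplier of `J` and divides every `E`-multiplier — the algebra of
  "multipliers of `J₀(N)` = `m_{E₁}·deg ψ₀·ℤ`" (ARS 2012 §2.1) with the Jacobian abstracted away;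
* `modularJacobianMultipliers_of_modularity_of_jacobian` (multiplier form) and
  `modularJacobianMultipliers_of_modularity_of_generators` (generator form): the item follows from
  modularity and the one input that needs the modular Jacobian as a `ℚ`-group scheme — for a
  minimal datum `D` and any such `E`, an abelian variety `J/ℚ` with `dim J ≤ g(X₀(N))` and
  generators `ι`, `π` of `Hom(E, J)`, `Hom(J, E)` with `ι ≫ π = D.modularDegree • 𝟙 E`
  (Shimura 1971 Thm. 7.14; ARS 2012 §2.1) — which is not constructible in the tree today (no
  `X₀(N)` as a scheme over `ℚ`, hence no `J₀(N)`);
* `exists_isNewformOf_of_modularJacobianMultipliers`: conversely the item implies the modularity of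
  every semistable elliptic curve over `ℚ` with a global minimal model (Wiles 1995), because a datum
  carries the newform of `W`; so the item cannot be closed before the named fact
  `Literature.NumberTheory.EllipticCurves.ModularForms.exists_isNewformOf` (semistable case) is a
  theorem of the tree.

## References

* G. Shimura, *Introduction to the arithmetic theory of automorphic functions* (1971), Prop. 1.40,
  1.43, Thm. 7.14.
* A. Agashe, K. Ribet, W. Stein, *The modular degree, congruence primes, and multiplicity one*
  (2012), §2.1.
* D. Zagier, *Modular parametrizations of elliptic curves*, Canad. Math. Bull. 28 (1985), Thm. 3.
* C. Breuil, B. Conrad, F. Diamond, R. Taylor, J. Amer. Math. Soc. 14 (2001), Thm. A.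
-/

-- `Summit.<Summit>.<Problem>` is the mandated summit-side namespace (CONVENTIONS §2); for the
-- single-conjunct summit `ABC` the two coincide, so the duplicate `ABC.ABC` is deliberate.
set_option linter.dupNamespace false

noncomputable section

open CategoryTheory
open Literature.NumberTheory.EllipticCurves.ModularForms
open Literature.AlgebraicGeometry.Motives

namespace Summit.ABC.ABC.Theorems

/-! ### `g(X₀(N)) ≤ N²` -/

/-- **`g(X₀(N)) ≤ N²`** for `N ≥ 1`: from the genus formula
`g = (12 + μ − 3ν₂ − 4ν₃ − 6ν_∞)/12 ≤ (12 + μ)/12` (Shimura Prop. 1.40 with 1.43) and `μ ≤ N²`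
(the tree's `gamma0Index_le_sq`, `RankinSymmSquareGL2Bound`); `(12 + N²)/12 ≤ N²` as soon as
`N ≥ 1`. This is the bound `dim J₀(N) = g(X₀(N)) ≤ N²` used by the item. -/
theorem genusX0_le_sq (N : ℕ) [NeZero N] : genusX0 N ≤ N ^ 2 := by
  have hN : N ≠ 0 := NeZero.ne N
  have hμ : gamma0Index N ≤ N ^ 2 := gamma0Index_le_sq hN
  have hN2 : 1 ≤ N ^ 2 := Nat.one_le_pow _ _ (Nat.pos_of_ne_zero hN)
  have h1 : genusX0 N ≤ (12 + gamma0Index N) / 12 := by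
    unfold genusX0
    exact Nat.div_le_div_right (by omega)
  calc genusX0 N ≤ (12 + gamma0Index N) / 12 := h1
    _ ≤ (12 + N ^ 2) / 12 := Nat.div_le_div_right (by omega)
    _ ≤ N ^ 2 := by omega

/-- `g(X₀(N)) ≤ N²` over `ℝ` (cast form of `genusX0_le_sq`), the shape of the dimension bound
`(J.dim : ℝ) ≤ (N : ℝ) ^ 2` in the item. -/
theorem genusX0_cast_le_sq (N : ℕ) [NeZero N] : (genusX0 N : ℝ) ≤ (N : ℝ) ^ 2 := by
  exact_mod_cast genusX0_le_sq N

/-! ### Minimal-degree parametrisation data -/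

/-- If `W` has some modular parametrisation datum at level `N`, it has one of minimal modular
degree among all its data at level `N` (well-ordering of `ℕ`). For the optimal curve this minimal
degree is the modular degree `m_E` of Zagier 1985 / Agashe–Ribet–Stein 2012 §2.1; for a general `W`
of the isogeny class it is `m_E` times the minimal degree of an isogeny from the optimal curve. -/
theorem exists_forall_modularDegree_le {W : WeierstrassCurve ℚ} {N : ℕ} [NeZero N]
    (h : Nonempty (ModularParametrizationData W N)) :
    ∃ D : ModularParametrizationData W N, ∀ D' : ModularParametrizationData W N,
      D.modularDegree ≤ D'.modularDegree := by
  classical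
  set S : Set ℕ := Set.range fun D : ModularParametrizationData W N ↦ D.modularDegree with hS_def
  have hS : S.Nonempty := ⟨_, h.some, rfl⟩
  obtain ⟨D, hD⟩ : sInf S ∈ S := Nat.sInf_mem hS
  have hD' : D.modularDegree = sInf S := hD
  exact ⟨D, fun D' ↦ hD' ▸ Nat.sInf_le ⟨D', rfl⟩⟩

/-- **Minimal data under modularity.** Granted the named fact `exists_isNewformOf` (the Modularity
Theorem, Breuil–Conrad–Diamond–Taylor 2001, Thm. A, level = conductor), every globally minimal
elliptic `W/ℚ` has a modular parametrisation datum at level `N_W` of minimal degree: existence is the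
tree's `nonempty_modularParametrizationData_of_modularity` (uniformisation `ℂ/Λ ≅ E(ℂ)` and the
integral Manin constant with a degree being theorems:
`IsNewformOf.exists_maninConstant_modularDegree_holds`), minimality is
`exists_forall_modularDegree_le`. -/
theorem exists_minimal_modularParametrizationData_of_modularity (hmod : exists_isNewformOf)
    (W : WeierstrassCurve ℚ) [W.IsElliptic] [W.IsGloballyMinimal] [NeZero (W.conductorNorm ℤ)] :
    ∃ D : ModularParametrizationData W (W.conductorNorm ℤ),
      ∀ D' : ModularParametrizationData W (W.conductorNorm ℤ), D.modularDegree ≤ D'.modularDegree :=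
  exists_forall_modularDegree_le
    (nonempty_modularParametrizationData_of_modularity hmod
      IsNewformOf.exists_maninConstant_modularDegree_holds W)

/-! ### The `E`-part: the elliptic curve as an abelian variety over `ℚ` -/

/-- **The `E`-part of the item is a theorem.** Every elliptic curve `W/ℚ` has an abelian variety
`E` over `ℚ` with a `Γ_ℚ`-equivariant additive isomorphism `E(ℚ̄) ≃+ W(ℚ̄)`: the smooth plane cubic of
`W` with the chord–tangent law (Silverman AEC III.3.1(c), III.3.6), in the tree
`WeierstrassCurve.nonempty_abelianVarietyBridge_holds` (bridge data for the pair `(W, W)`). -/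
theorem exists_abelianVariety_geomPoints_equiv (W : WeierstrassCurve ℚ) [W.IsElliptic] :
    ∃ (E : AbelianVariety.{0} ℚ) (e : E.geomPoints ≃+ W.geomPoints),
      ∀ (σ : Field.absoluteGaloisGroup ℚ) (P : E.geomPoints), e (σ • P) = σ • e P := by
  have hB : Nonempty (WeierstrassCurve.AbelianVarietyBridge W W) :=
    (WeierstrassCurve.nonempty_abelianVarietyBridge_iff W W).mp
      (WeierstrassCurve.nonempty_abelianVarietyBridge_holds W W)
  obtain ⟨B⟩ := hB
  exact ⟨B.A, B.e, B.e_smul⟩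

/-! ### `E`-multipliers of a rank-one pair -/

/-- **`[m] ≠ 0` on an abelian-variety model of an elliptic curve.** If `E/ℚ` is an abelian variety
with an additive isomorphism `E(ℚ̄) ≃+ W(ℚ̄)` onto the points of an elliptic curve `W/ℚ`, then
`m • 𝟙 E ≠ 0` for `m ≠ 0`: on geometric points `m • 𝟙 E` acts as multiplication by `m`
(`geomPointsMap` is additive in the morphism), so `m • 𝟙 E = 0` would make every point of `W(ℚ̄)`
an `m`-torsion point, whereas `W(ℚ̄)[m]` is finite (Silverman AEC III.6.4, the tree's
`WeierstrassCurve.finite_torsionPoints_holds`) and `W(ℚ̄)` is infinite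
(`WeierstrassCurve.geomPoints.instInfinite`). No Galois-equivariance is needed. -/
theorem zsmul_id_ne_zero_of_geomPoints_equiv {W : WeierstrassCurve ℚ} [W.IsElliptic]
    (E : AbelianVariety.{0} ℚ) (e : E.geomPoints ≃+ W.geomPoints) {m : ℤ} (hm : m ≠ 0) :
    m • 𝟙 E ≠ 0 := by
  intro h
  -- `m • 𝟙 E` acts on `E(ℚ̄)` as multiplication by `m`, hence `m • P = 0` for all `P`.
  have hE : ∀ P : E.geomPoints, m • P = 0 := fun P ↦ by
    have h1 := congrArg (fun f : E ⟶ E ↦ AbelianVariety.Hom.geomPointsMap f P) h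
    rw [← AbelianVariety.Hom.geomPointsMapAddMonoidHom_apply, map_zsmul,
      AbelianVariety.Hom.geomPointsMapAddMonoidHom_apply, AbelianVariety.Hom.geomPointsMap_id,
      AbelianVariety.Hom.geomPointsMap_zero, AddMonoidHom.zsmul_apply, AddMonoidHom.id_apply,
      AddMonoidHom.zero_apply] at h1
    exact h1
  -- transport to `W(ℚ̄)`
  have hW : ∀ Q : W.geomPoints, m • Q = 0 := fun Q ↦ by
    rw [← e.apply_symm_apply Q, ← map_zsmul, hE, map_zero]
  -- all of `W(ℚ̄)` is `m`-torsion: finite, contradicting `Infinite W(ℚ̄)`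
  have hfin : Finite (W.geomTorsion m) :=
    WeierstrassCurve.finite_torsionPoints_holds W (AlgebraicClosure ℚ) hm
  have htop : W.geomTorsion m = ⊤ := by
    rw [eq_top_iff]
    intro Q _
    exact (Submodule.mem_torsionBy_iff (R := ℤ) m Q).mpr (hW Q)
  rw [htop] at hfin
  have : Finite W.geomPoints :=
    (AddSubgroup.topEquiv : (⊤ : AddSubgroup W.geomPoints) ≃+ W.geomPoints).toEquiv.finite_iff.mp
      hfin
  exact not_finite W.geomPoints

/-- **Multipliers of a rank-one pair.** In a preadditive category let `ι : E ⟶ J`, `π : J ⟶ E`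
generate `Hom(E, J)` and `Hom(J, E)` over `ℤ`, with `ι ≫ π = d • 𝟙 E`, and suppose
`m • 𝟙 E = 0 → m = 0`. Then every `E`-multiplier of `J` is a multiple of `d`: if
`α ≫ β = n • 𝟙 E` then `α = b • ι`, `β = a • π`, so `n • 𝟙 E = (b a d) • 𝟙 E` and `n = a b d`.
This is the shape of the computation "the `E`-multipliers of `J₀(N)` are exactly
`m_{E₁} · deg ψ₀ · ℤ`" (Agashe–Ribet–Stein 2012 §2.1: `Hom(J₀(N), E₁) = ℤπ` by multiplicity one,
`π ∘ π^∨ = [m_{E₁}]`; Zagier 1985 Thm. 3), with the modular Jacobian abstracted away. -/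
theorem dvd_of_comp_eq_zsmul_id_of_generators {C : Type*} [Category C] [Preadditive C] {E J : C}
    (ι : E ⟶ J) (π : J ⟶ E) (d : ℤ) (hd : ι ≫ π = d • 𝟙 E)
    (hι : ∀ α : E ⟶ J, ∃ b : ℤ, α = b • ι) (hπ : ∀ β : J ⟶ E, ∃ a : ℤ, β = a • π)
    (hinj : ∀ m : ℤ, m • 𝟙 E = 0 → m = 0)
    {α : E ⟶ J} {β : J ⟶ E} {n : ℤ} (h : α ≫ β = n • 𝟙 E) : d ∣ n := by
  obtain ⟨b, rfl⟩ := hι α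
  obtain ⟨a, rfl⟩ := hπ β
  rw [Preadditive.zsmul_comp, Preadditive.comp_zsmul, hd, smul_smul, smul_smul] at h
  have h0 : (b * a * d - n) • 𝟙 E = 0 := by rw [sub_smul, h, sub_self]
  have := hinj _ h0
  exact ⟨b * a, by linear_combination -this⟩

/-- **The Jacobian input from generators.** For an abelian-variety model `E` of an elliptic curve
`W/ℚ` (`E(ℚ̄) ≃+ W(ℚ̄)`) and an abelian variety `J/ℚ` such that `Hom(E, J) = ℤι`, `Hom(J, E) = ℤπ`
and `ι ≫ π = d • 𝟙 E` with `d ≠ 0`, the two multiplier clauses of `ModularJacobianMultipliers`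
hold with divisor `d`: a non-zero `E`-multiplier exists (namely `d`) and every `E`-multiplier is
divisible by `d` (`dvd_of_comp_eq_zsmul_id_of_generators` with
`zsmul_id_ne_zero_of_geomPoints_equiv`). For `J = J₀(N)`, `W` semistable of conductor `N` and
`d = D.modularDegree` of a minimal datum this is the content of the item on `J₀(N)`
(Agashe–Ribet–Stein 2012 §2.1; Zagier 1985 Thm. 3). -/
theorem multipliers_of_generators {W : WeierstrassCurve ℚ} [W.IsElliptic]
    (E J : AbelianVariety.{0} ℚ) (e : E.geomPoints ≃+ W.geomPoints)
    (ι : E ⟶ J) (π : J ⟶ E) (d : ℤ) (hd0 : d ≠ 0) (hd : ι ≫ π = d • 𝟙 E)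
    (hι : ∀ α : E ⟶ J, ∃ b : ℤ, α = b • ι) (hπ : ∀ β : J ⟶ E, ∃ a : ℤ, β = a • π) :
    (∃ (α : E ⟶ J) (β : J ⟶ E) (n : ℤ), n ≠ 0 ∧ α ≫ β = n • 𝟙 E) ∧
      ∀ (α : E ⟶ J) (β : J ⟶ E) (n : ℤ), α ≫ β = n • 𝟙 E → d ∣ n :=
  ⟨⟨ι, π, d, hd0, hd⟩, fun _ _ _ h ↦ dvd_of_comp_eq_zsmul_id_of_generators ι π d hd hι hπ
    (fun _ hm ↦ by_contra fun hm0 ↦ zsmul_id_ne_zero_of_geomPoints_equiv E e hm0 hm) h⟩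

/-! ### The item from modularity and the Jacobian input -/

/-- **`ModularJacobianMultipliers` from modularity and the modular-Jacobian input.** Suppose
(i) `exists_isNewformOf` (modularity, BCDT 2001 Thm. A) and (ii) for every semistable globally
minimal elliptic `W/ℚ` of conductor `N`, every minimal-degree datum `D` of `W` at level `N` and
every abelian variety `E/ℚ` with a `Γ_ℚ`-equivariant `E(ℚ̄) ≃+ W(ℚ̄)`, there is an abelian variety
`J/ℚ` with `dim J ≤ g(X₀(N))`, a non-zero `E`-multiplier of `J`, and every `E`-multiplier of `J`
divisible by `D.modularDegree` — the statement furnished by `J = J₀(N)` (Shimura 1971, Thm. 7.14: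
the Jacobian of `X₀(N)` is an abelian variety over `ℚ` of dimension `g(X₀(N))`) with multiplicity
one for the optimal quotient (Agashe–Ribet–Stein 2012, §2.1; Zagier 1985, Thm. 3), not constructible
in the tree at present. Then the item holds: take the minimal datum
(`exists_minimal_modularParametrizationData_of_modularity`), the plane cubic
(`exists_abelianVariety_geomPoints_equiv`), the `J` of (ii), and `g(X₀(N)) ≤ N²`
(`genusX0_le_sq`). -/
theorem modularJacobianMultipliers_of_modularity_of_jacobian (hmod : exists_isNewformOf)
    (hJ : ∀ (W : WeierstrassCurve ℚ) [W.IsElliptic] [W.IsGloballyMinimal]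
      [NeZero (W.conductorNorm ℤ)], W.IsSemistable ℤ →
      ∀ D : ModularParametrizationData W (W.conductorNorm ℤ),
        (∀ D' : ModularParametrizationData W (W.conductorNorm ℤ),
          D.modularDegree ≤ D'.modularDegree) →
        ∀ (E : AbelianVariety.{0} ℚ) (e : E.geomPoints ≃+ W.geomPoints),
          (∀ (σ : Field.absoluteGaloisGroup ℚ) (P : E.geomPoints), e (σ • P) = σ • e P) →
          ∃ J : AbelianVariety.{0} ℚ, J.dim ≤ genusX0 (W.conductorNorm ℤ) ∧
            (∃ (α : E ⟶ J) (β : J ⟶ E) (n : ℤ), n ≠ 0 ∧ α ≫ β = n • 𝟙 E) ∧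
            ∀ (α : E ⟶ J) (β : J ⟶ E) (n : ℤ), α ≫ β = n • 𝟙 E → (D.modularDegree : ℤ) ∣ n) :
    Summit.ABC.ABC.Theses.IsogenyGlueCongruence.ModularJacobianMultipliers := by
  intro W _ _ _ hW
  obtain ⟨D, hD⟩ := exists_minimal_modularParametrizationData_of_modularity hmod W
  obtain ⟨E, e, he⟩ := exists_abelianVariety_geomPoints_equiv W
  obtain ⟨J, hdim, hex, hdvd⟩ := hJ W hW D hD E e he
  refine ⟨D, E, J, e, he, ?_, hex, hdvd⟩
  calc (J.dim : ℝ) ≤ genusX0 (W.conductorNorm ℤ) := by exact_mod_cast hdim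
    _ ≤ (W.conductorNorm ℤ : ℝ) ^ 2 := genusX0_cast_le_sq _

/-- **`ModularJacobianMultipliers` from modularity and the generator form of the Jacobian
input** — the form in which `J₀(N)` supplies it (Agashe–Ribet–Stein 2012 §2.1 with Faltings'
isogeny theorem: for `W` semistable of conductor `N` with optimal curve `E₁`, optimal quotient
`π₁ : J₀(N) → E₁` and a minimal isogeny `ψ₀ : E₁ → W`, `Hom(J₀(N), W) = ℤ(ψ₀ ∘ π₁)`,
`Hom(W, J₀(N)) = ℤ(π₁^∨ ∘ λ ∘ ψ₀')` and the composite `W → J₀(N) → W` is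
`[m_{E₁} · deg ψ₀] = [minimal modular degree of W]`): if for every semistable globally minimal
elliptic `W`, minimal datum `D` and model `(E, e)` there are `J` with `dim J ≤ g(X₀(N))` and
generators `ι`, `π` of `Hom(E, J)`, `Hom(J, E)` with `ι ≫ π = D.modularDegree • 𝟙 E`, then —
granted modularity — the item holds (`multipliers_of_generators`, `D.deg_pos`, and
`modularJacobianMultipliers_of_modularity_of_jacobian`). -/
theorem modularJacobianMultipliers_of_modularity_of_generators (hmod : exists_isNewformOf)
    (hJ : ∀ (W : WeierstrassCurve ℚ) [W.IsElliptic] [W.IsGloballyMinimal]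
      [NeZero (W.conductorNorm ℤ)], W.IsSemistable ℤ →
      ∀ D : ModularParametrizationData W (W.conductorNorm ℤ),
        (∀ D' : ModularParametrizationData W (W.conductorNorm ℤ),
          D.modularDegree ≤ D'.modularDegree) →
        ∀ (E : AbelianVariety.{0} ℚ) (e : E.geomPoints ≃+ W.geomPoints),
          (∀ (σ : Field.absoluteGaloisGroup ℚ) (P : E.geomPoints), e (σ • P) = σ • e P) →
          ∃ (J : AbelianVariety.{0} ℚ) (ι : E ⟶ J) (π : J ⟶ E),
            J.dim ≤ genusX0 (W.conductorNorm ℤ) ∧ ι ≫ π = (D.modularDegree : ℤ) • 𝟙 E ∧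
            (∀ α : E ⟶ J, ∃ b : ℤ, α = b • ι) ∧ (∀ β : J ⟶ E, ∃ a : ℤ, β = a • π)) :
    Summit.ABC.ABC.Theses.IsogenyGlueCongruence.ModularJacobianMultipliers := by
  refine modularJacobianMultipliers_of_modularity_of_jacobian hmod fun W _ _ _ hW D hD E e he ↦ ?_
  obtain ⟨J, ι, π, hdim, hd, hι, hπ⟩ := hJ W hW D hD E e he
  have hd0 : (D.modularDegree : ℤ) ≠ 0 := by exact_mod_cast D.deg_pos.ne'
  exact ⟨J, hdim, multipliers_of_generators E J e ι π _ hd0 hd hι hπ⟩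

/-! ### Conversely: the item implies semistable modularity -/

/-- **The item implies the modularity of semistable elliptic curves over `ℚ`** (Wiles 1995, in the
tree's "Version `a_p`" `IsNewformOf`): a parametrisation datum `D` of `W` at level `N_W` carries the
newform `D.f ∈ S₂(Γ₀(N_W))` of `W` (`D.isNewformOf : aₙ(f) = aₙ(W)`). Hence
`ModularJacobianMultipliers` cannot be proved in the tree before (the semistable case of) the named
fact `Literature.NumberTheory.EllipticCurves.ModularForms.exists_isNewformOf`. -/
theorem exists_isNewformOf_of_modularJacobianMultipliers
    (h : Summit.ABC.ABC.Theses.IsogenyGlueCongruence.ModularJacobianMultipliers)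
    (W : WeierstrassCurve ℚ) [W.IsElliptic] [W.IsGloballyMinimal] [NeZero (W.conductorNorm ℤ)]
    (hW : W.IsSemistable ℤ) :
    ∃ f : CuspForm (CongruenceSubgroup.Gamma0 (W.conductorNorm ℤ)) 2, IsNewformOf W f := by
  obtain ⟨D, -⟩ := h W hW
  exact ⟨D.f, D.isNewformOf⟩

end Summit.ABC.ABC.Theorems

end
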